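import Summits.Ventures.HSemireg.WedgeBoxCount

/-!
# Venture HSemireg — THEOREM K∘T for the box (4/8)

HONEST FRAMING. Part of the Lean index of the computation cell `pub-hsemireg` (seat p3; Sunday enclosure of the
FORMULA-N kernel assets of seats th-7 / th-6, ENCLOSURE-PLAN-p3.md).  Finite-dimensional exterior algebra over a field ONLY:
no variety, no cohomology theory, no semiregularity map is constructed here; nothing here says that HC / HC_CM / HC_AV holds;
no Literature fact is declared or used.  The geometric DICTIONARY (why these ranks are the `HT`-side box ranks of the cell's
STRUCTURE.md §1 / theory/FORMULA-N.md) lives in theory/FORMULA-N-th7.md PART B §A.3 / §N and is NOT asserted in Lean.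

THEOREM K∘T for the BOX of two point pairs (FORMULA-N PART A §2.3 / PART B §L; th-7 theory/th7/BoxRank.lean v4 sha256/16
88aeb4a1de514ae6, l.824–1175), file 4 of 8 — generators `I n := Fin (4n)` in four blocks `A 0 = X`, `A 1 = Y` (factor 1), `C 0 = X′`,
`C 1 = Y′` (factor 2); the coefficient-matrix box `boxClass c := Σ_{α,β} c α β • E_{A α ∪ C β}` and the HONEST box `fac1 a * fac2 a′`;
ranks of `θ ↦ θ ∧ box` on `⋀^k` in every degree: `4C(2n,k) − 4C(n,k)` (0 < k < n), the degree-n PURITY DROP `4C(2n,n) − 6` on the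
decomposable locus, `4C(2n,k) − 4C(n,k−n)` (n < k < 2n), `1` in degrees 0 and 2n; one citable form `finrank_range_wedgeMap_fac_mul_all`
(file 8).  No permutation sign is ever evaluated.  th-7's statements and proofs, unchanged (namespace `HSemiregBox` ↦
`Summit.Ventures.HSemireg.WedgeBox`; this family's Fin-indexed `B K n s` is its own, kept apart from `Wedge.B` / `WedgePair.B` by namespace).
Part II degree n: the T-trick (`B(A1) ∧ v ∈ K·B(A0) ∧ v`), `J`, independence, `range_eq_span_vecJ`, `card_J`, **`finrank_range_wedgeMap_fac_mul_degree_n`**: `finrank + 6 = 4·C(2n,n)` — the PURITY DROP (generic-c value `4C(2n,n) − 4` is NOT proved).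
-/

open Module Set Set.powersetCard

namespace Summit.Ventures.HSemireg.WedgeBox

variable (K : Type*) [Field K] {n : ℕ}

section DegreeN

/-- monomial times `f₁`: only the other `A`-block survives. -/
lemma B_A_mul_fac1 (hn : 0 < n) (a : Fin 2 → K) (α : Fin 2) :
    B K n (Apc n α : powersetCard (I n) n) * fac1 K n a =
      a (other α) • (B K n (Apc n α : powersetCard (I n) n) * B K n (Apc n (other α) : powersetCard (I n) n)) := by
  rw [fac1, Finset.mul_sum]
  rw [Finset.sum_eq_single (other α)]
  · rw [mul_smul_comm]
  · intro α' _ hα'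
    -- α' ≠ other α ⇒ α' = α ⇒ the square of a monomial vanishes
    have hαα : α' = α := by
      by_contra h; exact hα' (eq_other_of_ne h)
    subst hαα
    rw [mul_smul_comm, B_mul_B, sgn_of_not_disjoint K, zero_smul, smul_zero]
    rw [coe_Apc, Finset.disjoint_self_iff_empty, ← Finset.card_eq_zero, card_A]
    omega
  · intro h; exact (h (Finset.mem_univ _)).elim

/-- monomial times `f₂`: only the other `C`-block survives. -/
lemma B_C_mul_fac2 (hn : 0 < n) (a' : Fin 2 → K) (β : Fin 2) :
    B K n (Cpc n β : powersetCard (I n) n) * fac2 K n a' =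
      a' (other β) • (B K n (Cpc n β : powersetCard (I n) n) * B K n (Cpc n (other β) : powersetCard (I n) n)) := by
  rw [fac2, Finset.mul_sum]
  rw [Finset.sum_eq_single (other β)]
  · rw [mul_smul_comm]
  · intro β' _ hβ'
    have hββ : β' = β := by
      by_contra h; exact hβ' (eq_other_of_ne h)
    subst hββ
    rw [mul_smul_comm, B_mul_B, sgn_of_not_disjoint K, zero_smul, smul_zero]
    rw [coe_Cpc, Finset.disjoint_self_iff_empty, ← Finset.card_eq_zero, card_C]
    omega
  · intro h; exact (h (Finset.mem_univ _)).elim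

/-- a monomial of degree `m` commutes past `f₁` up to `(−1)^{mn}`. -/
lemma B_mul_fac1_comm {m : ℕ} (t : powersetCard (I n) m) (a : Fin 2 → K) :
    B K n t * fac1 K n a = ((-1 : K) ^ (m * n)) • (fac1 K n a * B K n t) := by
  simp only [fac1, Finset.mul_sum, Finset.sum_mul, mul_smul_comm, smul_mul_assoc, Finset.smul_sum]
  refine Finset.sum_congr rfl fun α _ => ?_
  rw [B_mul_B_comm K (Apc n α) t, smul_comm]

/-- `other` is an involution. -/
lemma other_other (α : Fin 2) : other (other α) = α := by
  unfold other; split_ifs with h1 h2 <;> omega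

/-- `other 0 = 1`. -/
@[simp] lemma other_zero : other (0 : Fin 2) = 1 := rfl

/-- `other 1 = 0`. -/
@[simp] lemma other_one : other (1 : Fin 2) = 0 := by decide

/-- the `T`-trick on factor 1: `E_{A1} ∧ v` is a multiple of `E_{A0} ∧ v`. -/
lemma vecA1_eq_smul_vecA0 (hn : 0 < n) (a a' : Fin 2 → K) (ha : ∀ α, a α ≠ 0) :
    B K n (Apc n 1 : powersetCard (I n) n) * (fac1 K n a * fac2 K n a') =
      (a 0 * (-1 : K) ^ (n * n) * (a 1)⁻¹) •
        (B K n (Apc n 0 : powersetCard (I n) n) * (fac1 K n a * fac2 K n a')) := by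
  rw [← mul_assoc, ← mul_assoc, B_A_mul_fac1 K hn, B_A_mul_fac1 K hn, other_one, other_zero,
    B_mul_B_comm K (Apc n 0) (Apc n 1)]
  simp only [smul_smul, smul_mul_assoc]
  congr 1
  rw [inv_mul_cancel_right₀ (ha 1)]

/-- the `T`-trick on factor 2 (after commuting the monomial past `f₁`). -/
lemma vecC1_eq_smul_vecC0 (hn : 0 < n) (a a' : Fin 2 → K) (ha' : ∀ β, a' β ≠ 0) :
    B K n (Cpc n 1 : powersetCard (I n) n) * (fac1 K n a * fac2 K n a') =
      (a' 0 * (-1 : K) ^ (n * n) * (a' 1)⁻¹) •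
        (B K n (Cpc n 0 : powersetCard (I n) n) * (fac1 K n a * fac2 K n a')) := by
  have h1 : ∀ δ : Fin 2, B K n (Cpc n δ : powersetCard (I n) n) * (fac1 K n a * fac2 K n a') =
      ((-1 : K) ^ (n * n) * a' (other δ)) •
        (fac1 K n a * (B K n (Cpc n δ : powersetCard (I n) n) * B K n (Cpc n (other δ) : powersetCard (I n) n))) := by
    intro δ
    rw [← mul_assoc, B_mul_fac1_comm K (Cpc n δ), smul_mul_assoc, mul_assoc (fac1 K n a),
      B_C_mul_fac2 K hn, mul_smul_comm, smul_smul]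
  rw [h1, h1, other_one, other_zero, B_mul_B_comm K (Cpc n 0) (Cpc n 1), mul_smul_comm, smul_smul,
    smul_smul]
  congr 1
  rw [show a' 0 * (-1 : K) ^ (n * n) * (a' 1)⁻¹ * ((-1) ^ (n * n) * a' 1) =
      (-1) ^ (n * n) * a' 0 * (-1) ^ (n * n) * ((a' 1)⁻¹ * a' 1) by ring,
    inv_mul_cancel₀ (ha' 1), mul_one]

/-! #### The reduced index set `J = Rel n n ∖ {A1, C1}` and its KEY lemma. -/

variable (n)

/-- relevant degree-`n` monomials other than the two redundant whole blocks `A 1`, `C 1`. -/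
noncomputable def J : Finset (Finset (I n)) :=
  (Rel n n).filter fun s => s ≠ A n 1 ∧ s ≠ C n 1

variable {n}

/-- membership in `J`: relevant of degree `n`, not one of the two redundant whole blocks. -/
lemma mem_J {s : Finset (I n)} : s ∈ J n ↔ s ∈ Rel n n ∧ s ≠ A n 1 ∧ s ≠ C n 1 := by
  rw [J, Finset.mem_filter]

/-- factor-1 and factor-2 blocks differ (`n > 0`). -/
lemma A_ne_C (hn : 0 < n) (α β : Fin 2) : A n α ≠ C n β := by
  intro h
  have hd := disjoint_A_C n α β
  rw [← h, Finset.disjoint_self_iff_empty, ← Finset.card_eq_zero, card_A] at hd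
  omega

/-- the two factor-1 blocks differ (`n > 0`). -/
lemma A_zero_ne_A_one (hn : 0 < n) : A n 0 ≠ A n 1 := by
  intro h
  have hd := disjoint_A_A n (show (0 : Fin 2) ≠ 1 by decide)
  rw [← h, Finset.disjoint_self_iff_empty, ← Finset.card_eq_zero, card_A] at hd
  omega

/-- the two factor-2 blocks differ (`n > 0`). -/
lemma C_zero_ne_C_one (hn : 0 < n) : C n 0 ≠ C n 1 := by
  intro h
  have hd := disjoint_C_C n (show (0 : Fin 2) ≠ 1 by decide)
  rw [← h, Finset.disjoint_self_iff_empty, ← Finset.card_eq_zero, card_C] at hd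
  omega

/-- a whole factor-1 block is a relevant degree-`n` monomial. -/
lemma A_mem_Rel (α : Fin 2) : A n α ∈ Rel n n :=
  mem_Rel.mpr (Or.inr (Or.inl ⟨α, mem_PureA.mpr ⟨subset_rfl, card_A n α⟩⟩))

/-- a whole factor-2 block is a relevant degree-`n` monomial. -/
lemma C_mem_Rel (β : Fin 2) : C n β ∈ Rel n n :=
  mem_Rel.mpr (Or.inr (Or.inr ⟨β, mem_PureC.mpr ⟨subset_rfl, card_C n β⟩⟩))

/-- `A 0 ∈ J`. -/
lemma A_zero_mem_J (hn : 0 < n) : A n 0 ∈ J n :=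
  mem_J.mpr ⟨A_mem_Rel 0, A_zero_ne_A_one hn, A_ne_C hn 0 1⟩

/-- `C 0 ∈ J`. -/
lemma C_zero_mem_J (hn : 0 < n) : C n 0 ∈ J n :=
  mem_J.mpr ⟨C_mem_Rel 0, (A_ne_C hn 1 0).symm, C_zero_ne_C_one hn⟩

/-- `αc` of a whole `A`-block is the other block. -/
lemma αc_A (hn : 0 < n) (α : Fin 2) : αc (A n α) = other α := by
  unfold αc
  by_cases h : α = 0
  · subst h
    rw [if_neg, other_zero]
    rw [Finset.disjoint_self_iff_empty, ← Finset.card_eq_zero, card_A]; omega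
  · have h1 : α = 1 := by omega
    subst h1
    rw [if_pos (disjoint_A_A n (show (1 : Fin 2) ≠ 0 by decide)), other_one]

/-- the chosen complementary factor-2 block of `C β` is `other β`. -/
lemma βc_C (hn : 0 < n) (β : Fin 2) : βc (C n β) = other β := by
  unfold βc
  by_cases h : β = 0
  · subst h
    rw [if_neg, other_zero]
    rw [Finset.disjoint_self_iff_empty, ← Finset.card_eq_zero, card_C]; omega
  · have h1 : β = 1 := by omega
    subst h1
    rw [if_pos (disjoint_C_C n (show (1 : Fin 2) ≠ 0 by decide)), other_one]

/-- KEY in degree `n`, on `J`: from `s' ∪ P α' β' = s ∪ P(canonical)` with the disjointness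
conditions one recovers `s' = s` and the pair — the two escape routes are exactly `A 1`, `C 1`. -/
lemma key_n (hn : 0 < n) {s s' : Finset (I n)} {α' β' : Fin 2} (hs : s ∈ J n) (hs' : s' ∈ J n)
    (hd' : Disjoint s' (P n α' β')) (h : s' ∪ P n α' β' = s ∪ P n (αc s) (βc s)) :
    α' = αc s ∧ β' = βc s ∧ s' = s := by
  obtain ⟨hsRel, hsA1, hsC1⟩ := mem_J.mp hs
  obtain ⟨hs'Rel, hs'A1, hs'C1⟩ := mem_J.mp hs'
  have hcard : s.card = n := card_of_mem_Rel hsRel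
  have hcard' : s'.card = n := card_of_mem_Rel hs'Rel
  have hd : Disjoint s (P n (αc s) (βc s)) := disjoint_P_canonical hsRel
  -- if α' is not canonical then `s = A α'`
  have hA : α' ≠ αc s → s = A n α' := by
    intro hne
    have hsub : A n α' ⊆ s ∪ P n (αc s) (βc s) := by
      rw [← h]; intro i hi; exact Finset.mem_union_right _ (by rw [P]; exact Finset.mem_union_left _ hi)
    have hsub' := A_subset_of_subset_union hne hsub
    exact (Finset.eq_of_subset_of_card_le hsub' (by rw [card_A, hcard])).symm
  have hC : β' ≠ βc s → s = C n β' := by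
    intro hne
    have hsub : C n β' ⊆ s ∪ P n (αc s) (βc s) := by
      rw [← h]; intro i hi; exact Finset.mem_union_right _ (by rw [P]; exact Finset.mem_union_right _ hi)
    have hsub' := C_subset_of_subset_union hne hsub
    exact (Finset.eq_of_subset_of_card_le hsub' (by rw [card_C, hcard])).symm
  -- s' is determined by the pair
  have hs'eq : s' = (s ∪ P n (αc s) (βc s)) \ P n α' β' := by
    rw [← h, Finset.union_sdiff_cancel_right hd']
  by_cases hα : α' = αc s
  · by_cases hβ : β' = βc s
    · subst hα hβ
      refine ⟨rfl, rfl, ?_⟩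
      rw [hs'eq, Finset.union_sdiff_cancel_right hd]
    · -- s = C β', canonical β is the other one, and then s' = C (other β') — one of them is C 1
      exfalso
      have hsC := hC hβ
      have hβc : βc s = other β' := by rw [hsC, βc_C hn]
      -- compute s'
      have hs'C : s' = C n (other β') := by
        rw [hs'eq, hβc, ← hα, hsC, P, P]
        ext i
        simp only [Finset.mem_sdiff, Finset.mem_union]
        constructor
        · rintro ⟨h1 | h2 | h3, h4⟩
          · exact (h4 (Or.inr h1)).elim
          · exact (h4 (Or.inl h2)).elim
          · exact h3
        · intro hi
          refine ⟨Or.inr (Or.inr hi), ?_⟩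
          rintro (h1 | h2)
          · exact Finset.disjoint_left.mp (disjoint_A_C n α' (other β')) h1 hi
          · exact Finset.disjoint_left.mp (disjoint_C_C n (other_ne β')) hi h2
      -- β' = 0 or 1
      by_cases hb : β' = 0
      · subst hb; rw [other_zero] at hs'C; exact hs'C1 hs'C
      · have hb1 : β' = 1 := by omega
        subst hb1; exact hsC1 hsC
  · exfalso
    have hsA := hA hα
    have hαc : αc s = other α' := by rw [hsA, αc_A hn]
    -- β' must be canonical (else s = C β' too)
    have hβ : β' = βc s := by
      by_contra hne
      exact A_ne_C hn α' β' (hsA.symm.trans (hC hne))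
    have hs'A : s' = A n (other α') := by
      rw [hs'eq, hαc, ← hβ, hsA, P, P]
      ext i
      simp only [Finset.mem_sdiff, Finset.mem_union]
      constructor
      · rintro ⟨h1 | h2 | h3, h4⟩
        · exact (h4 (Or.inl h1)).elim
        · exact h2
        · exact (h4 (Or.inr h3)).elim
      · intro hi
        refine ⟨Or.inr (Or.inl hi), ?_⟩
        rintro (h1 | h2)
        · exact Finset.disjoint_left.mp (disjoint_A_A n (other_ne α')) hi h1
        · exact Finset.disjoint_left.mp (disjoint_A_C n (other α') β') hi h2
    by_cases hb : α' = 0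
    · subst hb; rw [other_zero] at hs'A; exact hs'A1 hs'A
    · have hb1 : α' = 1 := by omega
      subst hb1; exact hsA1 hsA

/-! #### Linear independence on `J` and the count. -/

variable (c : Fin 2 → Fin 2 → K)

/-- `J` as a subtype of `Rel n n`. -/
def jRel (s : J n) : Rel n n := ⟨s.1, (mem_J.mp s.2).1⟩

/-- the family `E_s ∧ v`, `s ∈ J`. -/
noncomputable def vecJ (s : J n) : HT K n := vec K c (jRel s)

/-- pivot coordinates of the images of the `J`-monomials: diagonal with non-zero pivots. -/
lemma coord_piv_vecJ (hn : 0 < n) (s s' : J n) :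
    (B K n).coord (piv (jRel s)) (vecJ K c s') = if s' = s then pivCoeff K c (jRel s) else 0 := by
  classical
  rw [vecJ, vec, coord_B_mul_boxClass]
  have hds : Disjoint s.1 (P n (αc s.1) (βc s.1)) := disjoint_P_canonical (mem_J.mp s.2).1
  have hterm : ∀ α β, c α β * sgn K (relPc (jRel s')) (Ppc n α β) *
      (if (relPc (n := n) (jRel s')).val ∪ P n α β = piv (jRel s) then (1 : K) else 0) =
      if s' = s ∧ α = αc s.1 ∧ β = βc s.1 then pivCoeff K c (jRel s) else 0 := by
    intro α β
    by_cases hd : Disjoint (relPc (n := n) (jRel s')).val (P n α β)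
    · by_cases he : (relPc (n := n) (jRel s')).val ∪ P n α β = piv (jRel s)
      · obtain ⟨hα, hβ, hss⟩ := key_n hn s.2 s'.2 hd he
        have hs's : s' = s := Subtype.ext hss
        rw [if_pos he, mul_one, if_pos ⟨hs's, hα, hβ⟩, pivCoeff, hs's, hα, hβ]
        rfl
      · rw [if_neg he, mul_zero, if_neg]
        rintro ⟨rfl, rfl, rfl⟩
        exact he rfl
    · rw [sgn_of_not_disjoint K hd, mul_zero, zero_mul, if_neg]
      rintro ⟨rfl, rfl, rfl⟩
      exact hd hds
  simp_rw [hterm]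
  by_cases hs : s' = s
  · simp only [hs, true_and, if_true]
    rw [Finset.sum_eq_single (αc s.1) (fun α _ hα => by simp [hα]) (by simp),
      Finset.sum_eq_single (βc s.1) (fun β _ hβ => by simp [hβ]) (by simp)]
    simp
  · simp [hs]

/-- the dual functionals on `J`. -/
noncomputable def fnlJ (s : J n) : Module.Dual K (HT K n) := fnl K c (jRel s)

/-- the dual functionals are dual to the `J`-images (degree `n`). -/
lemma fnlJ_vecJ (hn : 0 < n) (hc : ∀ α β, c α β ≠ 0) (s s' : J n) :
    fnlJ K c s (vecJ K c s') = if s' = s then 1 else 0 := by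
  rw [fnlJ, fnl, LinearMap.smul_apply, coord_piv_vecJ K c hn, smul_eq_mul]
  split_ifs with h
  · exact inv_mul_cancel₀ (pivCoeff_ne_zero K c hc _)
  · exact mul_zero _

/-- the images of the `J`-monomials are linearly independent (degree `n`). -/
theorem vecJ_linearIndependent (hn : 0 < n) (hc : ∀ α β, c α β ≠ 0) :
    LinearIndependent K (vecJ K (n := n) c) := by
  apply LinearIndependent.of_pairwise_dual_eq_zero_one _ (fnlJ K c)
  · intro s s' hss'
    rw [fnlJ_vecJ K c hn hc, if_neg (Ne.symm hss')]
  · intro s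
    rw [fnlJ_vecJ K c hn hc, if_pos rfl]

/-- `card J + 2 = card (Rel n n)`. -/
lemma card_J (hn : 0 < n) : (J n).card + 2 = (Rel n n).card := by
  have h1 : J n = ((Rel n n).erase (A n 1)).erase (C n 1) := by
    ext s
    rw [mem_J, Finset.mem_erase, Finset.mem_erase]
    tauto
  have hA1 : A n 1 ∈ Rel n n := A_mem_Rel 1
  have hC1 : C n 1 ∈ (Rel n n).erase (A n 1) :=
    Finset.mem_erase.mpr ⟨(A_ne_C hn 1 1).symm, C_mem_Rel 1⟩
  rw [h1]
  have := Finset.card_erase_add_one hC1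
  have := Finset.card_erase_add_one hA1
  omega

/-- for the honest box, the range in degree `n` is spanned by the `J`-family. -/
theorem range_eq_span_vecJ (hn : 0 < n) {a a' : Fin 2 → K} (ha : ∀ α, a α ≠ 0) (ha' : ∀ β, a' β ≠ 0) :
    LinearMap.range (wedgeMap K n n (fac1 K n a * fac2 K n a')) =
      Submodule.span K (Set.range (vecJ K (n := n) (boxCoeff K (n := n) a a'))) := by
  rw [fac1_mul_fac2, range_eq_span_vec]
  apply le_antisymm
  · rw [Submodule.span_le]
    rintro _ ⟨s, rfl⟩
    rw [SetLike.mem_coe]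
    by_cases hJ : s.1 ∈ J n
    · exact Submodule.subset_span ⟨⟨s.1, hJ⟩, rfl⟩
    · -- s = A 1 or s = C 1
      have hs : s.1 = A n 1 ∨ s.1 = C n 1 := by
        have := s.2
        rw [mem_J, not_and, not_and_or, not_not, not_not] at hJ
        exact hJ this
      rcases hs with hs | hs
      · -- vec (A1) is a multiple of vec (A0)
        have hv : vec K (boxCoeff K (n := n) a a') s =
            (a 0 * (-1 : K) ^ (n * n) * (a 1)⁻¹) • vecJ K (boxCoeff K (n := n) a a') ⟨A n 0, A_zero_mem_J hn⟩ := by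
          rw [vecJ, vec, vec, ← fac1_mul_fac2]
          have e1 : B K n (relPc s) = B K n (Apc n 1 : powersetCard (I n) n) := by
            rw [B_apply_pc, B_apply_pc, coe_relPc, hs]; rfl
          have e0 : B K n (relPc (jRel ⟨A n 0, A_zero_mem_J hn⟩)) = B K n (Apc n 0 : powersetCard (I n) n) := by
            rw [B_apply_pc, B_apply_pc]; rfl
          rw [e1, e0, vecA1_eq_smul_vecA0 K hn a a' ha]
        rw [hv]
        exact Submodule.smul_mem _ _ (Submodule.subset_span ⟨_, rfl⟩)
      · have hv : vec K (boxCoeff K (n := n) a a') s =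
            (a' 0 * (-1 : K) ^ (n * n) * (a' 1)⁻¹) • vecJ K (boxCoeff K (n := n) a a') ⟨C n 0, C_zero_mem_J hn⟩ := by
          rw [vecJ, vec, vec, ← fac1_mul_fac2]
          have e1 : B K n (relPc s) = B K n (Cpc n 1 : powersetCard (I n) n) := by
            rw [B_apply_pc, B_apply_pc, coe_relPc, hs]; rfl
          have e0 : B K n (relPc (jRel ⟨C n 0, C_zero_mem_J hn⟩)) = B K n (Cpc n 0 : powersetCard (I n) n) := by
            rw [B_apply_pc, B_apply_pc]; rfl
          rw [e1, e0, vecC1_eq_smul_vecC0 K hn a a' ha']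
        rw [hv]
        exact Submodule.smul_mem _ _ (Submodule.subset_span ⟨_, rfl⟩)
  · apply Submodule.span_mono
    rintro _ ⟨s, rfl⟩
    exact ⟨jRel s, rfl⟩

/-- **THE PURITY DROP (FORMULA-N PART B §L.5, STRUCTURE C3/C14 reading), wedge model, every `n ≥ 1`**:
for the honest box `v = f₁ ∧ f₂` of two point-pair classes with all four coefficients non-zero, the rank of
`θ ↦ θ ∧ v` on `⋀^n(K^{4n})` is `4·C(2n,n) − 6` (two less than the generic box-class value `4·C(2n,n) − 4`:
the whole blocks `E_X, E_Y` have proportional images, and so do `E_{X′}, E_{Y′}`). -/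
theorem finrank_range_wedgeMap_fac_mul_degree_n (hn : 0 < n) {a a' : Fin 2 → K}
    (ha : ∀ α, a α ≠ 0) (ha' : ∀ β, a' β ≠ 0) :
    Module.finrank K (LinearMap.range (wedgeMap K n n (fac1 K n a * fac2 K n a'))) + 6 =
      4 * (n + n).choose n := by
  rw [range_eq_span_vecJ K hn ha ha',
    finrank_span_eq_card (vecJ_linearIndependent K _ hn (boxCoeff_ne_zero K ha ha')), Fintype.card_coe]
  have h1 := card_J (n := n) hn
  have h2 := card_Rel (n := n) (k := n) hn
  rw [Nat.choose_self] at h2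
  omega

end DegreeN

end Summit.Ventures.HSemireg.WedgeBox
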